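import Literature.Analysis.FluidPDE.AncientAxisymFarFieldSwirl
import Literature.Analysis.FluidPDE.LeiRenZhang2019SlidingVelocity
import HarnessLib

/-!
# Lei–Ren–Zhang 2019, Lemma 5.1 (ii): the swirl of a bounded ancient axisymmetric solution with
# bounded swirl flattens on parabolic cubes sliding to infinity

Analysis/FluidPDE **proofs file** (theorems only: no definitions, no named facts, no `sorry`) on
the discharge path of `Literature.Analysis.FluidPDE.leiRenZhang2019_sliding` (Lei–Ren–Zhang,
arXiv:1902.11229, §5 Lemma 5.1 "Sliding Property"): conjunct (ii) of the fact **verbatim** for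
the tree's duality-form bounded ancient mild solutions with measurable axisymmetric slices and
bounded swirl (`leiRenZhang2019_sliding_swirl_cubes`), by the route of
`LeiRenZhang2019SlidingVelocity` (class bridge, KNSS §4 representative
`KNSS2009_regularity_axisymmetric_swirl_holds`, every slice of `u` is `U(t)` plus an axial
constant, so `swirl (u t) = swirl (U t)` a.e. for every `t`) and the representative-level
theorem `farField_swirl_osc_of_axisymmetric_add_drift` (`AncientAxisymFarFieldSwirl`: Galilean
frame, parabolic rescaling, oscillation decay from the interior Harnack inequality with drift).

## References

* Z. Lei, X. Ren, Q. S. Zhang, *On ancient periodic solutions to axially-symmetric Navier–Stokes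
  equations*, arXiv:1902.11229, Lemma 5.1 and its proof (arXiv p. 13). [LeiRenZhang2019]
* G. Koch, N. Nadirashvili, G. Seregin, V. Šverák, Acta Math. 203 (2009) = arXiv:0709.3599, §4,
  (5.10). [KochNadirashviliSereginSverak2009]
-/

noncomputable section

open MeasureTheory Set Function Filter TopologicalSpace Metric WithLp
open _root_.Topology
open scoped RealInnerProductSpace NNReal ENNReal ContDiff

namespace Literature.Analysis.FluidPDE

section SlidingSwirl

/-- **Lei–Ren–Zhang 2019, Lemma 5.1 "Sliding Property", conjunct (ii) as printed** (parabolic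
cubes `Q_R(t₀, x₀) = B(x₀, R) × (t₀ − R², t₀)`, `t₀ ≤ 0`): for every bounded ancient mild solution
(`ν = 1`, duality form) with measurable, pointwise axisymmetric slices and bounded swirl
`|Γ| ≤ C`, and all `R, ε > 0`, there is `ρ` such that for every base point with `t₀ ≤ 0`,
`r(x₀) ≥ ρ`, all `t, t' ∈ (t₀ − R², t₀)` and a.e. `x, y ∈ B(x₀, R)`,
`|Γ(t, x) − Γ(t', y)| ≤ ε`. Proof: module docstring. [cite: LeiRenZhang2019, Lemma 5.1 (ii) and its proof (arXiv p. 13)] -/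
theorem leiRenZhang2019_sliding_swirl_cubes :
    ∀ u : ℝ → EuclideanSpace ℝ (Fin 3) → EuclideanSpace ℝ (Fin 3),
      IsBoundedAncientMildSolution 1 u →
      (∀ t < 0, AEStronglyMeasurable (u t) volume) →
        (∀ t < 0, IsAxisymmetric (u t)) →
          (∃ C : ℝ, ∀ t < 0, ∀ x, |swirl (u t) x| ≤ C) →
            ∀ R : ℝ, 0 < R → ∀ ε : ℝ, 0 < ε → ∃ ρ : ℝ, ∀ t₀ : ℝ, t₀ ≤ 0 →
              ∀ x₀ : EuclideanSpace ℝ (Fin 3), ρ ≤ cylRadius x₀ →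
                ∀ t ∈ Ioo (t₀ - R ^ 2) t₀, ∀ t' ∈ Ioo (t₀ - R ^ 2) t₀,
                  ∀ᵐ x ∂(volume : Measure (EuclideanSpace ℝ (Fin 3))),
                    ∀ᵐ y ∂(volume : Measure (EuclideanSpace ℝ (Fin 3))),
                      x ∈ Metric.ball x₀ R → y ∈ Metric.ball x₀ R →
                        |swirl (u t) x - swirl (u t') y| ≤ ε := by
  intro u hu hmeas haxi hswirl R hR ε hε
  obtain ⟨Csw, hCsw⟩ := hswirl
  have hν : (0 : ℝ) < 1 := one_pos
  -- the class bridge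
  obtain ⟨ũ, e, hũsol, hũjoint, hũsl, hũU⟩ :=
    exists_jointly_measurable_axial_modification hu hmeas haxi
  have hweak : IsBoundedWeakNSSolutionOn (Iio 0) isOpen_Iio 1 ũ :=
    hũsol.isBoundedWeakNSSolutionOn hν hũjoint hũsl
  have haxiU : ∀ t < 0, IsAxisymmetric fun x => u t x + e t • eZ := fun t ht =>
    isAxisymmetric_add_smul_eZ (haxi t ht) _
  have hax : ∀ θ : ℝ, ∀ᵐ t ∂((volume : Measure ℝ).restrict (Iio 0)),
      (fun x => ũ t (rotZ θ x)) =ᵐ[volume] fun x => rotZ θ (ũ t x) := by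
    intro θ
    filter_upwards [ae_restrict_mem measurableSet_Iio] with t ht
    have e1 : (fun x => ũ t (rotZ θ x)) =ᵐ[volume] fun x => u t (rotZ θ x) + e t • eZ :=
      (measurePreserving_rotZ θ).quasiMeasurePreserving.ae (hũU t ht)
    have e2 : (fun x => rotZ θ (ũ t x)) =ᵐ[volume] fun x => rotZ θ (u t x + e t • eZ) := by
      filter_upwards [hũU t ht] with x hx
      simp only [hx]
    have e3 : (fun x => u t (rotZ θ x) + e t • eZ) =ᵐ[volume]
        fun x => rotZ θ (u t x + e t • eZ) :=
      Eventually.of_forall fun x => haxiU t ht θ x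
    exact e1.trans (e3.trans e2.symm)
  -- KNSS §4: the regular representative `U + β(t) e_z` of `ũ`, with the swirl equation
  obtain ⟨U, β, hβm, ⟨Cβ, hβC⟩, hUjm, hrep, hsm, hdivU, haxU, hbdU, hlipU, hswirlEq⟩ :=
    KNSS2009_regularity_axisymmetric_swirl_holds hweak hax
  obtain ⟨M0, hM0'⟩ := hbdU 0
  have hUM : ∀ t < 0, ∀ x, ‖U t x‖ ≤ M0 := fun t ht x => by
    have h := hM0' t ht x
    rwa [norm_iteratedFDeriv_zero] at h
  have hU1 : ∀ t < 0, ContDiff ℝ 1 (U t) := fun t ht =>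
    (hsm t ht).of_le (by exact_mod_cast le_top)
  obtain ⟨M1, hM1'⟩ := hbdU 1
  have hUx : ∀ t < 0, ∀ x y, ‖U t x - U t y‖ ≤ M1 * ‖x - y‖ := by
    intro t ht x y
    have hd : ∀ z ∈ (univ : Set (EuclideanSpace ℝ (Fin 3))), DifferentiableAt ℝ (U t) z :=
      fun z _ => (hU1 t ht).differentiable one_ne_zero z
    have hb : ∀ z ∈ (univ : Set (EuclideanSpace ℝ (Fin 3))), ‖fderiv ℝ (U t) z‖ ≤ M1 :=
      fun z _ => by
        have h := hM1' t ht z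
        rwa [norm_iteratedFDeriv_one] at h
    exact convex_univ.norm_image_sub_le_of_norm_fderiv_le hd hb (mem_univ y) (mem_univ x)
  obtain ⟨L0, hL0'⟩ := hlipU 0
  have hUt : ∀ s < 0, ∀ t < 0, ∀ x, ‖U t x - U s x‖ ≤ L0 * |t - s| := fun s hs t ht x => by
    rw [norm_sub_eq_norm_iteratedFDeriv_zero_sub]
    exact hL0' s hs t ht x
  have hUwdiv : ∀ t < 0, IsWeaklyDivFree (U t) := fun t ht =>
    VectorCalculus.IsDivFree.isWeaklyDivFree_holds (hdivU t ht) (hU1 t ht)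
  have hUc : ∀ t < 0, Continuous (U t) := fun t ht => (hsm t ht).continuous
  -- the representative is itself a bounded weak solution
  have hsolU : IsBoundedWeakNSSolutionOn (Iio 0) isOpen_Iio 1 (fun t x => U t x + β t • eZ) := by
    refine hweak.congr_ae ?_ ⟨M0 + Cβ * ‖(eZ : EuclideanSpace ℝ (Fin 3))‖, fun t ht x => ?_⟩
      (hrep.mono fun t h => h.symm)
    · have hm : Measurable (uncurry fun t (x : EuclideanSpace ℝ (Fin 3)) => U t x + β t • eZ) :=
        hUjm.add ((hβm.comp measurable_fst).smul_const _)
      exact hm.aestronglyMeasurable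
    · calc ‖U t x + β t • eZ‖ ≤ ‖U t x‖ + ‖β t • eZ‖ := norm_add_le _ _
        _ ≤ M0 + Cβ * ‖(eZ : EuclideanSpace ℝ (Fin 3))‖ := by
            rw [norm_smul, Real.norm_eq_abs]
            exact add_le_add (hUM t ht x) (mul_le_mul_of_nonneg_right (hβC t) (norm_nonneg _))
  -- every slice of `u` is `U(t)` plus an axial constant
  have hslice : ∀ t < 0, ∃ c' : EuclideanSpace ℝ (Fin 3), ũ t =ᵐ[volume] fun x => U t x + c' :=
    hũsol.exists_ae_eq_add_const_slice hν hũsl (fun t ht => (hUc t ht).aestronglyMeasurable)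
      hUM hUt hUwdiv (c := fun t => β t • eZ) hrep
  have hslice_u : ∀ t < 0, ∃ a : ℝ, u t =ᵐ[volume] fun x => U t x + a • eZ := by
    intro t ht
    obtain ⟨c', hc'⟩ := hslice t ht
    have h1 : u t =ᵐ[volume] fun x => U t x + (c' - e t • eZ) := by
      filter_upwards [hũU t ht, hc'] with x hx hx'
      have hux : u t x = ũ t x - e t • eZ := by rw [hx, add_sub_cancel_right]
      rw [hux, hx', add_sub_assoc]
    have hw : IsAxisymmetric fun x => u t x - U t x := by
      intro θ x
      show u t (rotZ θ x) - U t (rotZ θ x) = rotZ θ (u t x - U t x)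
      rw [haxi t ht θ x, haxU t ht θ x, ← rotZL_apply, ← rotZL_apply, ← rotZL_apply, map_sub]
    have hwd : (fun x => u t x - U t x) =ᵐ[volume] fun _ => c' - e t • eZ := by
      filter_upwards [h1] with x hx
      rw [hx, add_sub_cancel_left]
    have hdax := eq_smul_eZ_of_ae_eq_const_of_isAxisymmetric hw hwd
    refine ⟨(c' - e t • eZ) 2, ?_⟩
    rw [← hdax]
    exact h1
  -- the swirls of `u` and `U` agree a.e., every `t`; the swirl bound passes to `U`
  have hswirl_ae : ∀ t < 0, ∀ᵐ x ∂(volume : Measure (EuclideanSpace ℝ (Fin 3))),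
      swirl (u t) x = swirl (U t) x := by
    intro t ht
    obtain ⟨a, ha⟩ := hslice_u t ht
    filter_upwards [ha] with x hx
    have e1 : swirl (U t) x = swirl (fun y => U t y + a • eZ) x := (swirl_add_smul_eZ (U t) a x).symm
    have e2 : swirl (fun y => U t y + a • eZ) x = swirl (u t) x := by simp only [swirl, hx]
    rw [e1, e2]
  have hswU : ∀ t < 0, ∀ x, |swirl (U t) x| ≤ Csw := by
    intro t ht
    have hae' : ∀ᵐ x ∂(volume : Measure (EuclideanSpace ℝ (Fin 3))), |swirl (U t) x| ≤ Csw := by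
      filter_upwards [hswirl_ae t ht] with x hx
      rw [← hx]; exact hCsw t ht x
    have hcont : Continuous fun x => |swirl (U t) x| := (contDiff_swirl (hU1 t ht)).continuous.abs
    have h := SereginSverak2009.forall_le_of_ae_le_of_continuousOn isOpen_univ hcont.continuousOn
      continuousOn_const (by rwa [Measure.restrict_univ])
    exact fun x => h x (mem_univ x)
  -- far-field flattening of the swirl of `U`, and of `u` (a.e.)
  obtain ⟨ρ, hρ⟩ := farField_swirl_osc_of_axisymmetric_add_drift hsolU hUM hUx hUt haxU hswU
    hUwdiv hβm hβC hsm hlipU hUjm hswirlEq R hR ε hε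
  refine ⟨ρ, fun t₀ ht₀ x₀ hx₀ t ht t' ht' => ?_⟩
  have htn : t < 0 := ht.2.trans_le ht₀
  have ht'n : t' < 0 := ht'.2.trans_le ht₀
  filter_upwards [hswirl_ae t htn] with x hx
  filter_upwards [hswirl_ae t' ht'n] with y hy
  intro hxb hyb
  rw [hx, hy]
  exact hρ t₀ ht₀ x₀ hx₀ t ht t' ht' x hxb y hyb

end SlidingSwirl

end Literature.Analysis.FluidPDE

end
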